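import Mathlib
import HarnessLib
import Summits.NavierStokesRegularity.NavierStokesRegularity.Theorems.UnthreadedRigidityDoorUnthreadedRigidityThreadingJetsVirialLemma
import Summits.NavierStokesRegularity.NavierStokesRegularity.Theorems.UnthreadedRigidityDoorUnthreadedRigidityThreadingJetsSplit
import Summits.NavierStokesRegularity.NavierStokesRegularity.Theorems.UnthreadedRigidityDoorUnthreadedRigidityThreadingJetsWindowGeneric
import Summits.NavierStokesRegularity.NavierStokesRegularity.Theorems.UnthreadedRigidityDoorUnthreadedRigidityVirialHornOrderTwoLaw
import Summits.NavierStokesRegularity.NavierStokesRegularity.Theorems.UnthreadedRigidityDoorUnthreadedRigidityVirialHornShellDecay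
import Summits.NavierStokesRegularity.NavierStokesRegularity.Theorems.UnthreadedRigidityDoorUnthreadedRigidityVirialHornWindowRung

/-!
# ★★★ THREADING JETS, VIRIAL COMPOSITIONS: the GENERIC ORDER-TWO SLICE LAW and BRIDGE V-W `VirialWindowSilence`, UNCONDITIONALLY, BY NAME

W2 ⟨stmt-NavierStokesRegularity-27585⟩ `UnthreadedRigidity`, line g11-1 (VIRIAL HORN), director split dss_146 (1).  Pure compositions of tree theorems:

* `orderTwoSliceLawGeneric_holds : OrderTwoSliceLawGeneric` — from (A) `VirialHorn.orderTwoLawSlice_holds` (ns-crc-p2) and (B′)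
  `virialLemmaSlice_holds` (file `…ThreadingJetsVirialLemma`) through the glue `orderTwoSliceLawGeneric_of_split` (file `…ThreadingJetsSplit`).
* ★ `virialWindowSilence_holds : VirialHorn.VirialWindowSilence` — BRIDGE V-W of the VIRIAL HORN card, now a tree theorem: the generic law,
  the shell-`L⁴` fact `VirialHorn.memLp_four_sepShellL` (ns-engine-1) and `virialWindowSilence_of_genericSliceLaw` (file `…WindowGeneric`:
  window pressure, decaying gauge, analyticity of the profile off the origin).
* the WINDOW RUNG with V-W discharged: `isotypicWindowRigidityL_of_bridgeW` (all degrees, from bridge W and the ANGULAR LEMMA),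
  `isotypicWindowRigidity_one_of_bridgeW`, `isotypicWindowRigidity_two_of_bridgeW` (degrees one and two, from bridge W alone).

HONEST LABEL: bridge W `WindowWedgeAnalyticL` and the all-degree `AngularLemma` remain hypotheses where they appear; ⟨27585⟩ `UnthreadedRigidity`,
W2 and NS regularity stay OPEN; MODEL rung — no NS regularity statement is proved here.
-/

noncomputable section

-- the summit and its single sub-problem share the name (CONVENTIONS §1), as in every Theorems file
set_option linter.dupNamespace false

namespace Summit.NavierStokesRegularity.NavierStokesRegularity.Theorems.UnthreadedRigidity.ThreadingJets

open Summit.NavierStokesRegularity.NavierStokesRegularity.Theorems.UnthreadedRigidity.VirialHorn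
  (VirialWindowSilence WindowWedgeAnalyticL AngularLemma IsotypicWindowRigidityL orderTwoLawSlice_holds memLp_four_sepShellL
    isotypicWindowRigidityL_of_bridges' isotypicWindowRigidity_one_of_bridges isotypicWindowRigidity_two_of_bridges')

/-- ★★★ THE GENERIC ORDER-TWO SLICE LAW `OrderTwoSliceLawGeneric`, BY NAME and unconditionally: halves (A) (`orderTwoLawSlice_holds`) and
(B′) (`virialLemmaSlice_holds`) glued by `orderTwoSliceLawGeneric_of_split`. -/
theorem orderTwoSliceLawGeneric_holds : OrderTwoSliceLawGeneric :=
  orderTwoSliceLawGeneric_of_split orderTwoLawSlice_holds virialLemmaSlice_holds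

/-- ★★★ BRIDGE V-W `VirialWindowSilence` OF THE VIRIAL HORN, BY NAME and unconditionally: the generic order-two slice law, the shell-`L⁴`
fact `memLp_four_sepShellL` and `virialWindowSilence_of_genericSliceLaw`. -/
theorem virialWindowSilence_holds : VirialWindowSilence :=
  virialWindowSilence_of_genericSliceLaw orderTwoSliceLawGeneric_holds memLp_four_sepShellL

/-- THE WINDOW RUNG WITH V-W DISCHARGED (all degrees): `IsotypicWindowRigidityL l n` from bridge W and the ANGULAR LEMMA
(`isotypicWindowRigidityL_of_bridges'` with `virialWindowSilence_holds`). -/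
theorem isotypicWindowRigidityL_of_bridgeW (l n : ℕ) (hl : 1 ≤ l) (hWA : WindowWedgeAnalyticL) (hC : AngularLemma) :
    IsotypicWindowRigidityL l n :=
  isotypicWindowRigidityL_of_bridges' l n hl hWA virialWindowSilence_holds hC

/-- DEGREE ONE, V-W DISCHARGED: `IsotypicWindowRigidityL 1 n` from bridge W alone. -/
theorem isotypicWindowRigidity_one_of_bridgeW (n : ℕ) (hWA : WindowWedgeAnalyticL) : IsotypicWindowRigidityL 1 n :=
  isotypicWindowRigidity_one_of_bridges n hWA virialWindowSilence_holds

/-- DEGREE TWO, V-W DISCHARGED: `IsotypicWindowRigidityL 2 n` from bridge W alone. -/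
theorem isotypicWindowRigidity_two_of_bridgeW (n : ℕ) (hWA : WindowWedgeAnalyticL) : IsotypicWindowRigidityL 2 n :=
  isotypicWindowRigidity_two_of_bridges' n hWA virialWindowSilence_holds

end Summit.NavierStokesRegularity.NavierStokesRegularity.Theorems.UnthreadedRigidity.ThreadingJets

end
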